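import Literature.Topology.PlanarFoliations.LeafJordan
import Literature.Topology.PlanarFoliations.Regions
import Literature.Topology.PlanarFoliations.ChainCofinal
import HarnessLib

/-!
# The limit of a strictly decreasing sequence of compact leaves

Topic: Topology / PlanarFoliations, sequel to `LeafJordan.lean` (discs of compact leaves as fills
of Jordan loops), `Regions.lean` / `FrontierLeaves.lean` (frontier leaves of saturated sets),
`ChainCofinal.lean`. For the chain-limit step of the minimiser scheme: let `K n` be compact leaves
of a bi-oriented planar foliation of `X ↪ ℂ` with **strictly decreasing discs**, and
`Dlim = ⋂ₙ discLeaf (K n)`. We prove: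

* `leaf_ne` / `image_leaf_disjoint_discLeaf_succ`: the leaves are distinct; the curve `K n` misses
  the next disc, hence `Dlim` (`image_leaf_disjoint_Dlim`);
* `isCompact_Dlim`, `Dlim_nonempty`;
* **saturation** (`image_leaf_subset_Dlim`): a leaf with a point in `Dlim` has its image in `Dlim`
  (it misses every `K n` and meets the inside of each); hence the preimage `ι ⁻¹' Dlim` is
  saturated, and so is its frontier, which is the preimage of `frontier Dlim`
  (`preimage_frontier_Dlim`, `isSaturated_preimage_frontier`);
* `frontier_Dlim_subset_closure` (**proved**): every frontier point of `Dlim` is a limit of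
  points of the curves `K n`, `n ≥ N`, for every `N`;
* `isCompact_or_of_mem_frontier_Dlim` (**proved**): for puncture data, **a leaf of the domain
  through a frontier point of `Dlim` is compact or a separatrix** (both limit sets single
  punctures; `FrontierLeaves.not_mem_omegaSet_of_subset_closure`).

## References

* C. Camacho, A. Lins Neto, *Geometric Theory of Foliations*, Birkhäuser (1985), Ch. VII §2
  [CamachoLinsNeto1985].
-/

noncomputable section

open Set Filter Function
open _root_.Topology
open Literature.Topology.FourManifolds Literature.Topology.FourManifolds.Foliation Literature.Topology.PlaneTopology

namespace Literature.Topology.PlanarFoliations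

variable {X : Type*} [TopologicalSpace X] [T2Space X] [SecondCountableTopology X] {F : Foliation ℝ X} {ι : X → ℂ}

section Chain

variable (hbi : IsBiOriented F) (hι : IsOpenEmbedding ι) {K : ℕ → X} (hK : ∀ n, IsCompact (F.leaf (K n)))
  (hdec : ∀ n, discLeaf F ι (K (n + 1)) ⊂ discLeaf F ι (K n))

/-- **The limit set**: the intersection of the discs. [folklore] -/
def Dlim (ι : X → ℂ) (F : Foliation ℝ X) (K : ℕ → X) : Set ℂ := ⋂ n, discLeaf F ι (K n)

include hdec in
omit [T2Space X] [SecondCountableTopology X] in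
/-- The discs decrease. [folklore] -/
theorem discLeaf_antitone : Antitone fun n ↦ discLeaf F ι (K n) := antitone_of_ssubset_succ hdec

include hdec in
omit [T2Space X] [SecondCountableTopology X] in
/-- **Consecutive leaves of the chain are distinct.** [folklore] -/
theorem leaf_succ_ne (n : ℕ) : F.leaf (K (n + 1)) ≠ F.leaf (K n) := fun h ↦ (hdec n).2 (by
  unfold discLeaf insideLeaf; rw [h])

include hbi hι hK hdec in
/-- **The curve `K n` misses the next disc.** [folklore] -/
theorem image_leaf_disjoint_discLeaf_succ (n : ℕ) : Disjoint (ι '' F.leaf (K n)) (discLeaf F ι (K (n + 1))) := by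
  obtain ⟨A, hA, hrA, -, hfillA⟩ := exists_isJordanLoop_leaf hbi hι (hK n)
  obtain ⟨C, hC, hrC, -, hfillC⟩ := exists_isJordanLoop_leaf hbi hι (hK (n + 1))
  have hne := leaf_succ_ne hdec n
  -- the curves are disjoint
  have hdisj : Disjoint (range A) (range C) := by
    rw [hrA, hrC, disjoint_left]
    rintro _ ⟨a, ha, rfl⟩ ⟨c, hc, hac⟩
    have : c = a := hι.injective hac
    subst this
    exact hne ((leaf_eq_of_mem hc).symm.trans (leaf_eq_of_mem ha))
  -- the smaller fill is in the bigger fill; its inside, open, is in the interior, off the curve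
  have hsubfill : IsJordanLoop.fill C ⊆ IsJordanLoop.fill A := by rw [hfillA, hfillC]; exact (hdec n).1
  rw [← hrA, ← hfillC]
  refine disjoint_left.2 fun z hzA hzC ↦ ?_
  rcases hzC with hzr | hzi
  · exact disjoint_left.1 hdisj hzA hzr
  · have hint : IsJordanLoop.inside C ⊆ interior (IsJordanLoop.fill A) :=
      interior_maximal (subset_union_right.trans hsubfill) hC.isOpen_inside
    rw [hA.interior_fill] at hint
    exact (hint hzi).1 hzA

include hbi hι hK hdec in
/-- **The curves of the chain miss the limit set.** [folklore] -/
theorem image_leaf_disjoint_Dlim (n : ℕ) : Disjoint (ι '' F.leaf (K n)) (Dlim ι F K) :=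
  (image_leaf_disjoint_discLeaf_succ hbi hι hK hdec n).mono_right (iInter_subset _ (n + 1))

include hbi hι hK in
/-- The limit set is compact. [folklore] -/
theorem isCompact_Dlim : IsCompact (Dlim ι F K) :=
  (isCompact_discLeaf hbi hι (hK 0)).of_isClosed_subset (isClosed_iInter fun n ↦ isClosed_discLeaf hbi hι (hK n)) (iInter_subset _ 0)

include hbi hι hK hdec in
/-- **The limit set is nonempty.** [folklore] -/
theorem Dlim_nonempty : (Dlim ι F K).Nonempty :=
  IsCompact.nonempty_iInter_of_sequence_nonempty_isCompact_isClosed _ (fun n ↦ (hdec n).1)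
    (fun n ↦ ⟨ι (K n), image_mem_discLeaf (F.mem_leaf_self _)⟩) (isCompact_discLeaf hbi hι (hK 0))
    fun n ↦ isClosed_discLeaf hbi hι (hK n)

include hbi hι hK hdec in
/-- **Saturation of the limit set**: a leaf with a point in the limit set has its image in it.
[folklore] -/
theorem image_leaf_subset_Dlim {y : X} (hy : ι y ∈ Dlim ι F K) : ι '' F.leaf y ⊆ Dlim ι F K := by
  refine subset_iInter fun n ↦ ?_
  have hyn : ι y ∈ discLeaf F ι (K n) := mem_iInter.1 hy n
  have hyK : y ∉ F.leaf (K n) := fun h ↦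
    disjoint_left.1 (image_leaf_disjoint_Dlim hbi hι hK hdec n) (mem_image_of_mem ι h) hy
  exact image_leaf_subset_discLeaf hbi hι (hK n) hyn

include hbi hι hK hdec in
/-- The preimage of the limit set is saturated. [folklore] -/
theorem isSaturated_preimage_Dlim : F.IsSaturated (ι ⁻¹' Dlim ι F K) := fun _ hy _ hz ↦
  image_leaf_subset_Dlim hbi hι hK hdec hy (mem_image_of_mem ι hz)

include hι in
omit [T2Space X] [SecondCountableTopology X] in
/-- For an open embedding, the preimage of the frontier of a closed set is the frontier of the
preimage. [folklore] -/
theorem preimage_frontier_eq {A : Set ℂ} (hA : IsClosed A) : ι ⁻¹' frontier A = frontier (ι ⁻¹' A) := by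
  have hint : ι ⁻¹' interior A = interior (ι ⁻¹' A) := by
    apply Subset.antisymm
    · exact preimage_interior_subset_interior_preimage hι.continuous
    · intro y hy
      have hopen : IsOpen (ι '' interior (ι ⁻¹' A)) := hι.isOpenMap _ isOpen_interior
      have hsub : ι '' interior (ι ⁻¹' A) ⊆ A := by
        rintro _ ⟨w, hw, rfl⟩
        exact (interior_subset (s := ι ⁻¹' A) hw : ι w ∈ A)
      exact interior_maximal hsub hopen (mem_image_of_mem ι hy)
  rw [hA.frontier_eq, (hA.preimage hι.continuous).frontier_eq, preimage_sdiff, hint]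

omit [T2Space X] [SecondCountableTopology X] in
/-- A preconnected plane set meeting a closed set and its complement meets its frontier.
[folklore] -/
theorem inter_frontier_nonempty_of_mem {s A : Set ℂ} (hs : IsPreconnected s) (hA : IsClosed A) {z u : ℂ} (hz : z ∈ s) (hzA : z ∈ A)
    (hu : u ∈ s) (huA : u ∉ A) : (s ∩ frontier A).Nonempty := by
  by_contra h
  rw [not_nonempty_iff_eq_empty] at h
  have hcover : s ⊆ interior A ∪ Aᶜ := by
    intro w hw
    by_cases hwA : w ∈ A
    · left
      by_contra hwi
      have : w ∈ s ∩ frontier A := ⟨hw, by rw [hA.frontier_eq]; exact ⟨hwA, hwi⟩⟩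
      rw [h] at this
      exact this
    · exact Or.inr hwA
  rcases hs.subset_or_subset isOpen_interior hA.isOpen_compl (disjoint_compl_right.mono_left interior_subset) hcover with h1 | h1
  · exact huA (interior_subset (h1 hu))
  · exact h1 hz hzA

include hbi hι hK hdec in
/-- **The frontier of the limit set is saturated** (read in the domain). [folklore] -/
theorem isSaturated_preimage_frontier : F.IsSaturated (ι ⁻¹' frontier (Dlim ι F K)) := by
  rw [preimage_frontier_eq hι (isCompact_Dlim hbi hι hK).isClosed]
  exact (isSaturated_preimage_Dlim hbi hι hK hdec).frontier

include hbi hι hK hdec in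
/-- **Every frontier point of the limit set is a limit of points of the curves `K n`, `n ≥ N`.**
[folklore] -/
theorem frontier_Dlim_subset_closure (N : ℕ) : frontier (Dlim ι F K) ⊆ closure (⋃ n ≥ N, ι '' F.leaf (K n)) := by
  intro z hz
  rw [mem_closure_iff_nhds]
  intro U hU
  obtain ⟨r, hr, hball⟩ := Metric.mem_nhds_iff.1 hU
  have hzD : z ∈ Dlim ι F K := (isCompact_Dlim hbi hι hK).isClosed.frontier_subset hz
  -- a point of the ball off the limit set, hence off some disc `K m`, `m ≥ N`
  have hfr := hz.2
  obtain ⟨u, hu, huD⟩ : ∃ u ∈ Metric.ball z r, u ∉ Dlim ι F K := by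
    by_contra h
    push Not at h
    exact hfr (mem_interior.2 ⟨Metric.ball z r, fun u hu ↦ h u hu, Metric.isOpen_ball, Metric.mem_ball_self hr⟩)
  obtain ⟨n, hn⟩ : ∃ n, u ∉ discLeaf F ι (K n) := by simpa [Dlim, mem_iInter] using huD
  set m := max n N with hm
  have hum : u ∉ discLeaf F ι (K m) := fun h ↦ hn (discLeaf_antitone hdec (le_max_left n N) h)
  have hzm : z ∈ discLeaf F ι (K m) := mem_iInter.1 hzD m
  -- the ball is connected and meets the disc and its complement: it meets the frontier, the curve
  have hconn : IsPreconnected (Metric.ball z r) := (convex_ball z r).isPreconnected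
  obtain ⟨w, hw, hwfr⟩ : (Metric.ball z r ∩ frontier (discLeaf F ι (K m))).Nonempty :=
    inter_frontier_nonempty_of_mem hconn (isClosed_discLeaf hbi hι (hK m)) (Metric.mem_ball_self hr) hzm hu hum
  rw [frontier_discLeaf hbi hι (hK m)] at hwfr
  exact ⟨w, hball hw, mem_biUnion (le_max_right n N) hwfr⟩

end Chain

/-! ## Frontier leaves of the limit set are compact or separatrices -/

section Punctures

variable {B : Type*} [NormedAddCommGroup B] {M : Type*} [TopologicalSpace M] {T : Foliation B M} {g : ℂ → M}
variable (D : PunctureData F ι T g) (hbi : IsBiOriented F) (hι : IsOpenEmbedding ι)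
  {K : ℕ → X} (hK : ∀ n, IsCompact (F.leaf (K n))) (hdec : ∀ n, discLeaf F ι (K (n + 1)) ⊂ discLeaf F ι (K n))

include hbi hι hK hdec in
/-- **A leaf through a frontier point of the limit set is compact, or open with both limit sets
single punctures** (a separatrix), provided the first disc lies in the region. [folklore] -/
theorem isCompact_or_of_mem_frontier_Dlim (hΩ : discLeaf F ι (K 0) ⊆ D.Ω) {y : X} (hy : ι y ∈ frontier (Dlim ι F K)) :
    IsCompact (F.leaf y) ∨ ∃ _ : NoncompactSpace (F.Leaf y),
      (∃ v ∈ D.P, omegaSet hbi ι y = {v} ∧ ∃ s ∈ D.levelLeaves v, y ∈ F.leaf s) ∧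
      (∃ v ∈ D.P, alphaSet hbi ι y = {v} ∧ ∃ s ∈ D.levelLeaves v, y ∈ F.leaf s) := by
  by_cases hcy : IsCompact (F.leaf y)
  · exact Or.inl hcy
  haveI := noncompactSpace_leaf_of_not_isCompact' hcy
  -- the leaf lies in the closure of the union `V` of the compact leaves `K n`
  set V : Set X := ⋃ n, F.leaf (K n) with hV
  have hVc : ∀ v ∈ V, IsCompact (F.leaf v) := fun v hv ↦ by
    obtain ⟨n, hn⟩ := mem_iUnion.1 hv
    rw [leaf_eq_of_mem hn]; exact hK n
  have hsat := isSaturated_preimage_frontier hbi hι hK hdec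
  have hL : F.leaf y ⊆ closure V := by
    intro w hw
    have hwfr : ι w ∈ frontier (Dlim ι F K) := hsat y hy hw
    have hcl := frontier_Dlim_subset_closure hbi hι hK hdec 0 hwfr
    -- pull the closure back along the open embedding
    rw [hι.isInducing.closure_eq_preimage_closure_image]
    refine closure_mono (fun z hz ↦ ?_) hcl
    obtain ⟨n, -, v, hv, rfl⟩ := mem_iUnion₂.1 hz
    exact ⟨v, mem_iUnion.2 ⟨n, hv⟩, rfl⟩
  -- the leaf lies in the compact first disc, in the region
  have hC : IsCompact (discLeaf F ι (K 0)) := isCompact_discLeaf hbi hι (hK 0)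
  have hyD : ι y ∈ Dlim ι F K := (isCompact_Dlim hbi hι hK).isClosed.frontier_subset hy
  have hmem : ∀ q : F.Leaf y, ι (Leaf.pt q) ∈ discLeaf F ι (K 0) := fun q ↦
    mem_iInter.1 (image_leaf_subset_Dlim hbi hι hK hdec hyD ⟨Leaf.pt q, q.2, rfl⟩) 0
  have hP : ∀ {z}, z ∈ discLeaf F ι (K 0) → z ∉ range ι → z ∈ D.P := fun {z} hz hzr ↦ by
    by_contra hzP
    exact hzr (D.mem_range (hΩ hz) hzP)
  have hωP : omegaSet hbi ι y ⊆ D.P := fun z hz ↦ hP (omegaSet_subset_of_forall_mem hC.isClosed hmem hz) (by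
    rintro ⟨y', rfl⟩; exact not_mem_omegaSet_of_subset_closure hι hVc hL y' hz)
  have hαP : alphaSet hbi ι y ⊆ D.P := fun z hz ↦ hP (alphaSet_subset_of_forall_mem hC.isClosed hmem hz) (by
    rintro ⟨y', rfl⟩; exact not_mem_alphaSet_of_subset_closure hι hVc hL y' hz)
  exact Or.inr ⟨inferInstance, D.exists_omegaSet_eq_singleton hι hC hmem hωP, D.exists_alphaSet_eq_singleton hι hC hmem hαP⟩

end Punctures

end Literature.Topology.PlanarFoliations
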